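import Mathlib
import HarnessLib
import Summits.ValiantsHypothesis.ValiantsHypothesis.Theorems.MonotoneRestorationOrbitCompressionQPOrbitToNarrowOfDescent
import Summits.ValiantsHypothesis.ValiantsHypothesis.Theorems.MonotoneRestorationOrbitRestorationLinearVolumeQPBipartiteUnfolding
import Summits.ValiantsHypothesis.ValiantsHypothesis.Theorems.MonotoneRestorationOrbitRestorationLinearVolumeQPOrbitSpanCharacterisation
import Summits.ValiantsHypothesis.ValiantsHypothesis.Theorems.MonotoneRestorationOrbitCompressionQPLevelFloor

/-!
# Route MonotoneRestoration — aside `OrbitCompressionQP` (stmt-ValiantsHypothesis-18332), line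
# `expression_compression`: THE REPAIRED FIRST STUB IS *EQUIVALENT* TO QUASI-POLYNOMIAL DESCENT

`OrbitToNarrowOfDescent.orbitToNarrowExpression_of_qpDescent` (p829832) proved: ABOVE-THRESHOLD qp-DESCENT (for every
`c` a `c'` such that every MATRIX-symmetric `p` at level `n`, `2 · deg p > n`, in the span of the ONE-SORTED homomorphism
polynomials `dihom_{D,n}` of treewidth `≤ (log₂ n + c)^c` lies in the span of the BIPARTITE `hom_{F,n}` of treewidth
`≤ (log₂ n + c')^{c'}`) ⟹ THE REPAIRED STUB 1 (matrix-symmetric `f` + square-symmetric circuits of quasi-polynomial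
ORBIT size ⇒ closed bipartite pattern expressions with `n^{k+l} ≤ 2^{(log₂ n + c)^c}`, verbatim the registered
conclusion).  This file proves the CONVERSE, so that the open content of the (repaired) first stub of the
registered line is EXACTLY one statement of invariant theory, with no circuit and no family in it:

  ★ `stub1_iff_qpDescentAbove` :  REPAIRED STUB 1  ⟺  ABOVE-THRESHOLD qp-DESCENT  ⟺  qp-DESCENT (all degrees).

Proof of "stub 1 ⟹ descent" (`qpDescent_of_stub1`, a diagonal / compactness argument).  Suppose descent fails for
`c`: for every `c'` some matrix-symmetric `p_{c'} ∈ U_c(n_{c'}) \ W_{c'}(n_{c'})`.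
(1) LEVEL FLOOR (`LevelFloor.mem_narrowSpan_level_of_matrixSymmetric`, part 1/2, from the Reynolds/orbit-sum induction of
`HomSpan`, re-run with the level instead of the degree as the bound): every matrix-symmetric polynomial at level `n`
lies in `W` of width `2n - 1`; hence a width-`(log₂ n + c')^{c'}` failure forces `c' < 2n` and `n ≥ 2` — failures
for large `c'` live at large levels, and at each level only finitely many `c'` fail.
(2) THE DIAGONAL FAMILY: at each level `n` pick a failure `p` for the LARGEST failing `c' ≤ 2n` (`Nat.findGreatest`),
else `0`.  This family is matrix-symmetric and lies level-wise in `U_c`, so it has quasi-polynomial ORBITS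
(`OrbitSupport.qpOrbitFamily_of_diNarrowSpan`: one-sorted K2 + the orbit circuit, p829254).
(3) Stub 1 gives ONE `c₂` and closed bipartite expressions with `n^{k+l} ≤ 2^{(log₂ n + c₂)^{c₂}}` on every level;
the TWO-SORTED UNFOLDING (`BipartiteUnfoldingColoured.close_mem_narrowSpan`, p830xxx of hand `-8-g1`) puts the
family in `W_{c₂}(n)` for `n ≥ 2`; but the level `n` of a failure for `c₂` carries, by construction, a failure for
some `c' ≥ c₂` as the family's value — contradiction by monotonicity of `W` in `c'`.

* (part 1/2, `…OrbitCompressionQPLevelFloor.lean`: the level floor `LevelFloor.mem_narrowSpan_level_of_matrixSymmetric`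
  and the bookkeeping `two_le_of_not_mem`, `lt_level_of_not_mem`);
* `mem_narrowSpan_of_close_eq` — the stub currency `n^{k+l} ≤ 2^{(log₂ n + c)^c}` feeds `W_c(n)` (`n ≥ 2`);
* ★ `qpDescent_of_stub1` — REPAIRED STUB 1 ⟹ qp-DESCENT IN ALL DEGREES;
* ★ `stub1_iff_qpDescentAbove`, `stub1_iff_qpDescent`, `qpDescentAbove_iff_qpDescent` — the equivalences.

Consequences recorded for the planner: (i) re-cutting Stub 1 with matrix symmetry (the 0-math repair of
`…OrbitToNarrowExpressionFalse`) produces a stub that is PROVABLY THE SAME THING as qp-descent (S1c) — no weaker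
port exists along this line; (ii) by `…OrbitCompressionQPReynoldsDescent` / the `(4,4)` survey (evidence
S1c-descent-g10.md) same-width descent is false, so the loss `c ↦ c'` is genuine.  Honest label: an equivalence of two
OPEN statements plus an unconditional level floor; Stub 2, the aside and VP ≠ VNP are NOT moved.  Def-free helper
(`--supports stmt-ValiantsHypothesis-18332`); nothing here is a named fact.

References: Dawar–Pago–Seppelt 2025 (arXiv:2502.06740) Thm 1.1, Remark p. 17, §7 p. 45; Dwivedi–Pago–Seppelt 2026
(arXiv:2601.09343) §8 (Lemma 8.18), Outlook Q3.
-/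

noncomputable section

open scoped Classical

-- `Summit.ValiantsHypothesis.ValiantsHypothesis.…` is the tree's single-conjunct layout (Sub = Summit).
set_option linter.dupNamespace false

namespace Summit.ValiantsHypothesis.ValiantsHypothesis.Theorems

namespace StubOneIffDescent

open Literature.Computability.AlgebraicComplexity MvPolynomial
open Literature.Combinatorics.SimpleGraph (treewidth)

open LevelFloor

/-! ### The stub currency feeds the narrow span -/

/-- **Narrow expressions lie in the narrow span** (level-wise, `n ≥ 2`): a closed bipartite expression with
`n^{k+l} ≤ 2^{(log₂ n + c)^c}` — the currency of the registered stubs of line `expression_compression` — has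
`k + l ≤ (log₂ n + c)^c` labels, hence (two-sorted unfolding `BipartiteUnfoldingColoured.close_mem_narrowSpan`) lies in
the bipartite narrow span of width `(log₂ n + c)^c`. [folklore] -/
theorem mem_narrowSpan_of_close_eq {n c k l : ℕ} (hn : 2 ≤ n) (e : PatternExpr ℂ k l)
    (hk : n ^ (k + l) ≤ 2 ^ ((Nat.log 2 n + c) ^ c)) :
    e.close n ∈ Submodule.span ℂ {q : MvPolynomial (Fin n × Fin n) ℂ |
      ∃ (a b : ℕ) (F : Multiset (Fin a × Fin b)),
        treewidth (SimpleGraph.fromRel fun u v : Fin a ⊕ Fin b =>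
            ∃ e ∈ F, u = Sum.inl e.1 ∧ v = Sum.inr e.2) ≤ (Nat.log 2 n + c) ^ c ∧ q = homPoly F n ℂ} := by
  have hkl : k + l ≤ (Nat.log 2 n + c) ^ c := by
    have h2 : 2 ^ (k + l) ≤ 2 ^ ((Nat.log 2 n + c) ^ c) := le_trans (Nat.pow_le_pow_left hn _) hk
    exact (Nat.pow_le_pow_iff_right Nat.one_lt_two).1 h2
  exact BipartiteUnfoldingColoured.close_mem_narrowSpan k l n _ (by omega) e

/-- **NARROW EXPRESSIONS ⟹ NARROW SPAN (family form).**  The conclusion of the repaired `stub_orbitToNarrowExpression`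
(= the hypothesis of `stub_narrowExpressionCompression`) puts `f n`, on every level `n ≥ 2`, in the bipartite narrow
span of width `(log₂ n + c)^c` — the conclusion currency of `stub_lvNarrowSpan` of the sibling aside
`OrbitRestorationLinearVolumeQP` and of qp-descent. [folklore] -/
theorem narrowSpan_of_narrowExpressions (f : (n : ℕ) → MvPolynomial (Fin n × Fin n) ℂ)
    (h : ∃ c : ℕ, ∀ n : ℕ, 1 ≤ n → ∃ (k l : ℕ) (e : PatternExpr ℂ k l),
      n ^ (k + l) ≤ 2 ^ ((Nat.log 2 n + c) ^ c) ∧ e.close n = f n) :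
    ∃ c : ℕ, ∀ n : ℕ, 2 ≤ n → f n ∈ Submodule.span ℂ {q : MvPolynomial (Fin n × Fin n) ℂ |
      ∃ (a b : ℕ) (F : Multiset (Fin a × Fin b)),
        treewidth (SimpleGraph.fromRel fun u v : Fin a ⊕ Fin b =>
            ∃ e ∈ F, u = Sum.inl e.1 ∧ v = Sum.inr e.2) ≤ (Nat.log 2 n + c) ^ c ∧ q = homPoly F n ℂ} := by
  obtain ⟨c, hc⟩ := h
  refine ⟨c, fun n hn => ?_⟩
  obtain ⟨k, l, e, hk, he⟩ := hc n (by omega)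
  rw [← he]
  exact mem_narrowSpan_of_close_eq hn e hk

/-! ### Repaired Stub 1 ⟹ qp-descent (the diagonal family) -/

/-- ★ **THE REPAIRED STUB 1 IMPLIES QUASI-POLYNOMIAL DESCENT IN ALL DEGREES.**  If every matrix-symmetric family
with square-symmetric circuits of quasi-polynomial orbit size is, for one `c` and all `n ≥ 1`, a closed bipartite
expression with `n^{k+l} ≤ 2^{(log₂ n + c)^c}` (the repaired `stub_orbitToNarrowExpression`, universally over
families), then for every `c` there is `c'` such that on EVERY level every matrix-symmetric polynomial in the
one-sorted narrow span of width `(log₂ n + c)^c` lies in the bipartite narrow span of width `(log₂ n + c')^{c'}`.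
(Diagonal family over the failures, level floor, orbit circuits from the one-sorted span, two-sorted unfolding —
see the module docstring.) [cite: DawarPagoSeppelt2025, Theorem 1.1 and §7 (p. 45)] -/
theorem qpDescent_of_stub1
    (stub1 : ∀ f : (n : ℕ) → MvPolynomial (Fin n × Fin n) ℂ,
      (∀ (n : ℕ) (σ τ : Equiv.Perm (Fin n)),
        rename (fun ij : Fin n × Fin n => (σ ij.1, τ ij.2)) (f n) = f n) →
      (∃ c : ℕ, ∀ n : ℕ, ∃ (G : Type) (_ : Fintype G)
          (C : LabelledArithCircuit ℂ (Fin n × Fin n) Unit G),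
        C.IsSymmetric (Equiv.Perm (Fin n)) ∧ C.eval (C.output ()) = f n ∧
        C.orbitSize (Equiv.Perm (Fin n)) ≤ 2 ^ ((Nat.log 2 n + c) ^ c)) →
      ∃ c : ℕ, ∀ n : ℕ, 1 ≤ n → ∃ (k l : ℕ) (e : PatternExpr ℂ k l),
        n ^ (k + l) ≤ 2 ^ ((Nat.log 2 n + c) ^ c) ∧ e.close n = f n)
    (c : ℕ) :
    ∃ c' : ℕ, ∀ (n : ℕ) (p : MvPolynomial (Fin n × Fin n) ℂ),
      (∀ σ τ : Equiv.Perm (Fin n), rename (fun ij : Fin n × Fin n => (σ ij.1, τ ij.2)) p = p) →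
      p ∈ Submodule.span ℂ {q : MvPolynomial (Fin n × Fin n) ℂ |
        ∃ (a : ℕ) (D : Multiset (Fin a × Fin a)),
          treewidth (SimpleGraph.fromRel fun u v : Fin a => ∃ e ∈ D, u = e.1 ∧ v = e.2) ≤
            (Nat.log 2 n + c) ^ c ∧ q = diHomPoly D n ℂ} →
      p ∈ Submodule.span ℂ {q : MvPolynomial (Fin n × Fin n) ℂ | ∃ (a b : ℕ) (F : Multiset (Fin a × Fin b)),
        treewidth (SimpleGraph.fromRel fun u v : Fin a ⊕ Fin b =>
            ∃ e ∈ F, u = Sum.inl e.1 ∧ v = Sum.inr e.2) ≤ (Nat.log 2 n + c') ^ c' ∧ q = homPoly F n ℂ} := by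
  by_contra H
  push Not at H
  -- `Wit n c' p`: `p` is a matrix-symmetric failure of width-`c'` descent at level `n`
  let Wit : (n : ℕ) → ℕ → MvPolynomial (Fin n × Fin n) ℂ → Prop := fun n c' p =>
    (∀ σ τ : Equiv.Perm (Fin n), rename (fun ij : Fin n × Fin n => (σ ij.1, τ ij.2)) p = p) ∧
    p ∈ Submodule.span ℂ {q : MvPolynomial (Fin n × Fin n) ℂ |
        ∃ (a : ℕ) (D : Multiset (Fin a × Fin a)),
          treewidth (SimpleGraph.fromRel fun u v : Fin a => ∃ e ∈ D, u = e.1 ∧ v = e.2) ≤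
            (Nat.log 2 n + c) ^ c ∧ q = diHomPoly D n ℂ} ∧
    p ∉ Submodule.span ℂ {q : MvPolynomial (Fin n × Fin n) ℂ | ∃ (a b : ℕ) (F : Multiset (Fin a × Fin b)),
        treewidth (SimpleGraph.fromRel fun u v : Fin a ⊕ Fin b =>
            ∃ e ∈ F, u = Sum.inl e.1 ∧ v = Sum.inr e.2) ≤ (Nat.log 2 n + c') ^ c' ∧ q = homPoly F n ℂ}
  have hWit : ∀ c', ∃ (n : ℕ) (p : MvPolynomial (Fin n × Fin n) ℂ), Wit n c' p := fun c' => by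
    obtain ⟨n, p, hp, hU, hW⟩ := H c'
    exact ⟨n, p, hp, hU, hW⟩
  -- the largest failing constant at each level (failing constants at level `n` are `< 2n`)
  let P : (n : ℕ) → ℕ → Prop := fun n c' => ∃ p : MvPolynomial (Fin n × Fin n) ℂ, Wit n c' p
  let m : ℕ → ℕ := fun n => Nat.findGreatest (P n) (2 * n)
  have hmax : ∀ (n c' : ℕ) (p : MvPolynomial (Fin n × Fin n) ℂ), Wit n c' p → P n (m n) ∧ c' ≤ m n := by
    intro n c' p hw
    have hc' : c' ≤ 2 * n := (lt_level_of_not_mem p hw.1 hw.2.2).le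
    exact ⟨Nat.findGreatest_spec hc' ⟨p, hw⟩, Nat.le_findGreatest hc' ⟨p, hw⟩⟩
  -- the diagonal family
  let f : (n : ℕ) → MvPolynomial (Fin n × Fin n) ℂ := fun n =>
    if h : P n (m n) then Classical.choose h else 0
  have hf_pos : ∀ n (h : P n (m n)), f n = Classical.choose h := fun n h => by
    simp only [f, dif_pos h]
  have hf_neg : ∀ n, ¬ P n (m n) → f n = 0 := fun n h => by
    simp only [f, dif_neg h]
  have hfsymm : ∀ (n : ℕ) (σ τ : Equiv.Perm (Fin n)),
      rename (fun ij : Fin n × Fin n => (σ ij.1, τ ij.2)) (f n) = f n := by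
    intro n σ τ
    by_cases h : P n (m n)
    · rw [hf_pos n h]
      exact (Classical.choose_spec h).1 σ τ
    · rw [hf_neg n h, map_zero]
  have hfU : ∀ n : ℕ, f n ∈ Submodule.span ℂ {q : MvPolynomial (Fin n × Fin n) ℂ |
      ∃ (a : ℕ) (D : Multiset (Fin a × Fin a)),
        treewidth (SimpleGraph.fromRel fun u v : Fin a => ∃ e ∈ D, u = e.1 ∧ v = e.2) ≤
          (Nat.log 2 n + c) ^ c ∧ q = diHomPoly D n ℂ} := by
    intro n
    by_cases h : P n (m n)
    · rw [hf_pos n h]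
      exact (Classical.choose_spec h).2.1
    · rw [hf_neg n h]
      exact Submodule.zero_mem _
  have hfdiag : ∀ (n : ℕ) (σ : Equiv.Perm (Fin n)), ren σ (f n) = f n := by
    intro n σ
    have hfun : (fun x : Fin n × Fin n => σ • x) = fun ij : Fin n × Fin n => (σ ij.1, σ ij.2) :=
      funext fun _ => rfl
    unfold ren
    rw [hfun]
    exact hfsymm n σ σ
  -- quasi-polynomial orbits (one-sorted K2 + the orbit circuit), then Stub 1, then unfold
  have horb := OrbitSupport.qpOrbitFamily_of_diNarrowSpan f hfdiag ⟨c, hfU⟩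
  obtain ⟨c₂, hc₂⟩ := stub1 f hfsymm horb
  obtain ⟨n, p, hw⟩ := hWit c₂
  have hn : 2 ≤ n := two_le_of_not_mem p hw.1 hw.2.2
  obtain ⟨hP, hle⟩ := hmax n c₂ p hw
  have hq : Wit n (m n) (f n) := by
    rw [hf_pos n hP]
    exact Classical.choose_spec hP
  obtain ⟨k, l, e, hk, he⟩ := hc₂ n (by omega)
  apply hq.2.2
  rw [← he]
  have hmono : (Nat.log 2 n + c₂) ^ c₂ ≤ (Nat.log 2 n + m n) ^ (m n) := by
    rcases Nat.eq_zero_or_pos (m n) with h0 | hpos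
    · have hc0 : c₂ = 0 := Nat.le_zero.1 (h0 ▸ hle)
      rw [h0, hc0]
    · exact le_trans (Nat.pow_le_pow_left (by omega) _) (Nat.pow_le_pow_right (by omega) hle)
  exact OrbitToNarrowOfDescent.narrowSpan_mono n hmono (mem_narrowSpan_of_close_eq hn e hk)

/-! ### The equivalences -/

/-- **ABOVE-THRESHOLD qp-DESCENT ⟺ qp-DESCENT IN ALL DEGREES** (below the injective threshold `2 · deg ≤ n` descent
holds with the same width, `SubThresholdDescent.subThreshold_descent`; packaged in
`OrbitToNarrowOfDescent.qpDescent_of_aboveThreshold`). [folklore] -/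
theorem qpDescentAbove_iff_qpDescent :
    (∀ c : ℕ, ∃ c' : ℕ, ∀ (n : ℕ) (p : MvPolynomial (Fin n × Fin n) ℂ),
      (∀ σ τ : Equiv.Perm (Fin n), rename (fun ij : Fin n × Fin n => (σ ij.1, τ ij.2)) p = p) →
      n < 2 * p.totalDegree →
      p ∈ Submodule.span ℂ {q : MvPolynomial (Fin n × Fin n) ℂ |
        ∃ (a : ℕ) (D : Multiset (Fin a × Fin a)),
          treewidth (SimpleGraph.fromRel fun u v : Fin a => ∃ e ∈ D, u = e.1 ∧ v = e.2) ≤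
            (Nat.log 2 n + c) ^ c ∧ q = diHomPoly D n ℂ} →
      p ∈ Submodule.span ℂ {q : MvPolynomial (Fin n × Fin n) ℂ | ∃ (a b : ℕ) (F : Multiset (Fin a × Fin b)),
        treewidth (SimpleGraph.fromRel fun u v : Fin a ⊕ Fin b =>
            ∃ e ∈ F, u = Sum.inl e.1 ∧ v = Sum.inr e.2) ≤ (Nat.log 2 n + c') ^ c' ∧ q = homPoly F n ℂ}) ↔
    (∀ c : ℕ, ∃ c' : ℕ, ∀ (n : ℕ) (p : MvPolynomial (Fin n × Fin n) ℂ),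
      (∀ σ τ : Equiv.Perm (Fin n), rename (fun ij : Fin n × Fin n => (σ ij.1, τ ij.2)) p = p) →
      p ∈ Submodule.span ℂ {q : MvPolynomial (Fin n × Fin n) ℂ |
        ∃ (a : ℕ) (D : Multiset (Fin a × Fin a)),
          treewidth (SimpleGraph.fromRel fun u v : Fin a => ∃ e ∈ D, u = e.1 ∧ v = e.2) ≤
            (Nat.log 2 n + c) ^ c ∧ q = diHomPoly D n ℂ} →
      p ∈ Submodule.span ℂ {q : MvPolynomial (Fin n × Fin n) ℂ | ∃ (a b : ℕ) (F : Multiset (Fin a × Fin b)),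
        treewidth (SimpleGraph.fromRel fun u v : Fin a ⊕ Fin b =>
            ∃ e ∈ F, u = Sum.inl e.1 ∧ v = Sum.inr e.2) ≤ (Nat.log 2 n + c') ^ c' ∧ q = homPoly F n ℂ}) :=
  ⟨OrbitToNarrowOfDescent.qpDescent_of_aboveThreshold,
    fun h c => (h c).imp fun _ hc' n p hp _ hmem => hc' n p hp hmem⟩

/-- ★★ **THE REPAIRED STUB 1 ⟺ ABOVE-THRESHOLD qp-DESCENT.**  The first stub of line `expression_compression`,
repaired with matrix symmetry (`…OrbitToNarrowExpressionFalse`) and read universally over families — "every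
matrix-symmetric family with square-symmetric circuits of quasi-polynomial ORBIT size is, for one `c` and every
`n ≥ 1`, the closed polynomial of a bipartite pattern expression with `n^{k+l} ≤ 2^{(log₂ n + c)^c}`" — holds IF AND
ONLY IF above-threshold quasi-polynomial descent holds.  (`⟸`: `OrbitToNarrowOfDescent.orbitToNarrowExpression_of_qpDescent`,
p829832; `⟹`: `qpDescent_of_stub1`.)  The open content of the repaired stub is therefore exactly the one-sorted →
two-sorted passage S1c above the injective threshold, a circuit-free statement about two spans of invariant polynomials.
[cite: DawarPagoSeppelt2025, Theorem 1.1 and §7 (p. 45)] -/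
theorem stub1_iff_qpDescentAbove :
    (∀ f : (n : ℕ) → MvPolynomial (Fin n × Fin n) ℂ,
      (∀ (n : ℕ) (σ τ : Equiv.Perm (Fin n)),
        rename (fun ij : Fin n × Fin n => (σ ij.1, τ ij.2)) (f n) = f n) →
      (∃ c : ℕ, ∀ n : ℕ, ∃ (G : Type) (_ : Fintype G)
          (C : LabelledArithCircuit ℂ (Fin n × Fin n) Unit G),
        C.IsSymmetric (Equiv.Perm (Fin n)) ∧ C.eval (C.output ()) = f n ∧
        C.orbitSize (Equiv.Perm (Fin n)) ≤ 2 ^ ((Nat.log 2 n + c) ^ c)) →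
      ∃ c : ℕ, ∀ n : ℕ, 1 ≤ n → ∃ (k l : ℕ) (e : PatternExpr ℂ k l),
        n ^ (k + l) ≤ 2 ^ ((Nat.log 2 n + c) ^ c) ∧ e.close n = f n) ↔
    (∀ c : ℕ, ∃ c' : ℕ, ∀ (n : ℕ) (p : MvPolynomial (Fin n × Fin n) ℂ),
      (∀ σ τ : Equiv.Perm (Fin n), rename (fun ij : Fin n × Fin n => (σ ij.1, τ ij.2)) p = p) →
      n < 2 * p.totalDegree →
      p ∈ Submodule.span ℂ {q : MvPolynomial (Fin n × Fin n) ℂ |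
        ∃ (a : ℕ) (D : Multiset (Fin a × Fin a)),
          treewidth (SimpleGraph.fromRel fun u v : Fin a => ∃ e ∈ D, u = e.1 ∧ v = e.2) ≤
            (Nat.log 2 n + c) ^ c ∧ q = diHomPoly D n ℂ} →
      p ∈ Submodule.span ℂ {q : MvPolynomial (Fin n × Fin n) ℂ | ∃ (a b : ℕ) (F : Multiset (Fin a × Fin b)),
        treewidth (SimpleGraph.fromRel fun u v : Fin a ⊕ Fin b =>
            ∃ e ∈ F, u = Sum.inl e.1 ∧ v = Sum.inr e.2) ≤ (Nat.log 2 n + c') ^ c' ∧ q = homPoly F n ℂ}) := by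
  constructor
  · intro stub1
    exact qpDescentAbove_iff_qpDescent.2 (qpDescent_of_stub1 stub1)
  · intro hdesc f hsymm horb
    exact OrbitToNarrowOfDescent.orbitToNarrowExpression_of_qpDescent hdesc f hsymm horb

/-- **THE REPAIRED STUB 1 ⟺ qp-DESCENT IN ALL DEGREES** (same, through `qpDescentAbove_iff_qpDescent`).
[cite: DawarPagoSeppelt2025, Theorem 1.1 and §7 (p. 45)] -/
theorem stub1_iff_qpDescent :
    (∀ f : (n : ℕ) → MvPolynomial (Fin n × Fin n) ℂ,
      (∀ (n : ℕ) (σ τ : Equiv.Perm (Fin n)),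
        rename (fun ij : Fin n × Fin n => (σ ij.1, τ ij.2)) (f n) = f n) →
      (∃ c : ℕ, ∀ n : ℕ, ∃ (G : Type) (_ : Fintype G)
          (C : LabelledArithCircuit ℂ (Fin n × Fin n) Unit G),
        C.IsSymmetric (Equiv.Perm (Fin n)) ∧ C.eval (C.output ()) = f n ∧
        C.orbitSize (Equiv.Perm (Fin n)) ≤ 2 ^ ((Nat.log 2 n + c) ^ c)) →
      ∃ c : ℕ, ∀ n : ℕ, 1 ≤ n → ∃ (k l : ℕ) (e : PatternExpr ℂ k l),
        n ^ (k + l) ≤ 2 ^ ((Nat.log 2 n + c) ^ c) ∧ e.close n = f n) ↔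
    (∀ c : ℕ, ∃ c' : ℕ, ∀ (n : ℕ) (p : MvPolynomial (Fin n × Fin n) ℂ),
      (∀ σ τ : Equiv.Perm (Fin n), rename (fun ij : Fin n × Fin n => (σ ij.1, τ ij.2)) p = p) →
      p ∈ Submodule.span ℂ {q : MvPolynomial (Fin n × Fin n) ℂ |
        ∃ (a : ℕ) (D : Multiset (Fin a × Fin a)),
          treewidth (SimpleGraph.fromRel fun u v : Fin a => ∃ e ∈ D, u = e.1 ∧ v = e.2) ≤
            (Nat.log 2 n + c) ^ c ∧ q = diHomPoly D n ℂ} →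
      p ∈ Submodule.span ℂ {q : MvPolynomial (Fin n × Fin n) ℂ | ∃ (a b : ℕ) (F : Multiset (Fin a × Fin b)),
        treewidth (SimpleGraph.fromRel fun u v : Fin a ⊕ Fin b =>
            ∃ e ∈ F, u = Sum.inl e.1 ∧ v = Sum.inr e.2) ≤ (Nat.log 2 n + c') ^ c' ∧ q = homPoly F n ℂ}) :=
  stub1_iff_qpDescentAbove.trans qpDescentAbove_iff_qpDescent

end StubOneIffDescent

end Summit.ValiantsHypothesis.ValiantsHypothesis.Theorems

end
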